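import Summits.BirchSwinnertonDyer.BirchSwinnertonDyer.Theorems.ThetaPartnerAtTwoMazurTateCongruenceAtTwoRDepletedPeriodLattice
import Literature.NumberTheory.EllipticCurves.ModularParametrizationDegreeHoldsProofs
import Literature.NumberTheory.EllipticCurves.EichlerShimuraOptimalQuotientLattice
import Literature.NumberTheory.EllipticCurves.EichlerShimuraConstruction
import Literature.NumberTheory.EllipticCurves.ComplexMultiplicationLFunctionIsogenyHoldsProofs
import Literature.NumberTheory.EllipticCurves.LFunctionPrimeCoeff
import HarnessLib

/-!
# The assembled named fact `eichlerShimura_depletedOptimalQuotient_periodLattice(_of_dvd)` FROM THE STANDARD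
# Eichler–Shimura construction `eichlerShimuraConstruction` — a reduction for its other consumers
# (width seat bsd-wall-tp2-p1-w2 g5; `--supports stmt-BirchSwinnertonDyer-25797`; THEOREMS ONLY — no `def`, no `sorry`; BSD is not proved)

The named facts `eichlerShimura_depletedOptimalQuotient_periodLattice` / `…_of_dvd` (`EichlerShimuraOptimalQuotientLattice.lean`: for a rational
newform `f`, a nonempty finite set `S` of primes and the `S`-depleted form `g` at a level `L` with `N∏ℓ² ∣ L`, an elliptic curve `A/ℚ` with Néron
lattice `c·Λ_g` and `a_p(A) = a_p(g)` for almost all `p`) are ASSEMBLED statements with no single printed source, cited by many files of the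
routes ThetaPartnerAtTwo / ResidualThetaTransportAtTwo. This file proves both from the mainstream named fact `eichlerShimuraConstruction`
(`EichlerShimuraConstruction.lean`: a rational newform `f` is the newform of SOME elliptic curve `W/ℚ`; Knapp Thm. 11.74, Carayol, BCDT (2)⇒(6)):
given such `W`, the tree theorem `DepletedLattice.exists_depletedLatticeCurve_isIsogenous` (p636031, fed with the tree theorem
`IsNewformOf.exists_maninConstant_ne_zero_holds`) produces `A` with `Λ_A = c·Λ_g` and `A ~_ℚ W`, and isogenous curves have the same
`L`-function (`IsIsogenous.LFunction_eq`, a theorem of the tree), so `a_p(A) = a_p(W) = a_p(f) = a_p(g)` at every good prime `p ∉ S` of `A`.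

* `eichlerShimura_depletedOptimalQuotient_periodLattice_of_dvd_of_construction : eichlerShimuraConstruction → …_of_dvd`;
* `eichlerShimura_depletedOptimalQuotient_periodLattice_of_construction : eichlerShimuraConstruction → …` (fixed level, via the tree's
  `eichlerShimura_depletedOptimalQuotient_periodLattice_of_of_dvd`).

For the K1 crux itself neither fact is needed any more (`mazurTateCongruenceAtTwoTop_of_sdBzAu`, `…TopOfManinConstant`); this is library
hygiene for the remaining consumers. Conditional on `eichlerShimuraConstruction`; nothing closes an item; BSD is not proved by any of this.

References: A. W. Knapp, *Elliptic Curves* (1993) Thm. 11.74, Thm. 12.8 [Knapp1993]; A. Agashe, K. Ribet, W. Stein, PAMQ 2 (2006) §2–3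
[AgasheRibetStein2006]; G. Faltings, Invent. Math. 73 (1983) §5 Kor. 2 [Faltings1983Endlichkeit].
-/

noncomputable section

-- justification: the `Summit.BirchSwinnertonDyer.BirchSwinnertonDyer.…` path repeats a component (route-file convention)
set_option linter.dupNamespace false
set_option autoImplicit false

open scoped MatrixGroups ModularForm

open CongruenceSubgroup WeierstrassCurve
open Literature.NumberTheory.EllipticCurves Literature.NumberTheory.EllipticCurves.ModularForms

namespace Summit.BirchSwinnertonDyer.BirchSwinnertonDyer.Theorems.MazurTateCongruenceAtTwoR.DepletedLattice

/-- **`eichlerShimuraConstruction → eichlerShimura_depletedOptimalQuotient_periodLattice_of_dvd`.** Given the Eichler–Shimura curve `W` of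
the rational newform `f` (`IsNewformOf W f`), the curve `A = ℂ/Λ_g` over `ℚ` of `exists_depletedLatticeCurve_isIsogenous` (global minimal model,
Néron lattice `c·Λ_g`, `A ~_ℚ W`) has `a_p(A) = a_p(W) = a_p(f) = a_p(g)` for every prime `p ∉ S` of good reduction for `A`
(`IsIsogenous.LFunction_eq`, `LFunction_apply_prime_eq_frobeniusTrace`), i.e. for all but finitely many `p`.
[cite: Knapp1993, Thm. 11.74 (d)(e)] [cite: AgasheRibetStein2006, §3 (pp. 620–621)] -/
theorem eichlerShimura_depletedOptimalQuotient_periodLattice_of_dvd_of_construction (hESC : eichlerShimuraConstruction) :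
    eichlerShimura_depletedOptimalQuotient_periodLattice_of_dvd := by
  intro N _ f hf hint S hS _ L _ hNL _ g hg
  classical
  obtain ⟨W, hW, hWf, -⟩ := hESC hf hint
  obtain ⟨A, hAell, hAmin, LA, c, hLA, hc, hlat, hiso⟩ :=
    exists_depletedLatticeCurve_isIsogenous IsNewformOf.exists_maninConstant_ne_zero_holds W hWf S hS L hNL g hg
  refine ⟨A, hAell, hAmin, LA, c, hLA, hc, hlat, ?_⟩
  -- `a_n(W) = a_n(A)` for all `n` (isogenous curves have the same `L`-function)
  have hL : W.LFunction = A.LFunction := hiso.LFunction_eq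
  -- the exceptional primes divide `Δ_min(A)` or lie in `S`
  set D : ℤ := A.minimalDiscriminantInt with hD
  have hD0 : D ≠ 0 := A.minimalDiscriminantInt_ne_zero
  refine ((Set.finite_Iic D.natAbs).union (S : Set ℕ).toFinite).subset ?_
  rintro p ⟨hp, hne⟩
  by_contra hmem
  simp only [Set.mem_union, Set.mem_Iic, Finset.mem_coe, not_or] at hmem
  obtain ⟨hpD, hpS⟩ := hmem
  haveI : Fact p.Prime := ⟨hp⟩
  have hndvd : ¬ (p : ℤ) ∣ D := fun h ↦ hpD (Nat.le_of_dvd (Int.natAbs_pos.mpr hD0) (Int.ofNat_dvd_left.mp h))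
  have hgood : A.HasGoodReductionAtPrime p := hasGoodReductionAtPrime_of_not_dvd A p hndvd
  apply hne
  rw [hg p, if_neg (by
      rintro ⟨ℓ, hℓ, hd⟩
      exact hpS (((Nat.prime_dvd_prime_iff_eq (hS ℓ hℓ) hp).mp hd) ▸ hℓ)),
    hWf.2 p, hL, LFunction_apply_prime_eq_frobeniusTrace A p hgood]

/-- **Fixed-level form**: `eichlerShimuraConstruction → eichlerShimura_depletedOptimalQuotient_periodLattice` (the case `L = N·∏_{ℓ∈S} ℓ²`, via
the tree's `eichlerShimura_depletedOptimalQuotient_periodLattice_of_of_dvd`). [cite: Knapp1993, Thm. 11.74 (d)(e)]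
[cite: AgasheRibetStein2006, §3 (pp. 620–621)] -/
theorem eichlerShimura_depletedOptimalQuotient_periodLattice_of_construction (hESC : eichlerShimuraConstruction) :
    eichlerShimura_depletedOptimalQuotient_periodLattice :=
  eichlerShimura_depletedOptimalQuotient_periodLattice_of_of_dvd
    (eichlerShimura_depletedOptimalQuotient_periodLattice_of_dvd_of_construction hESC)

end Summit.BirchSwinnertonDyer.BirchSwinnertonDyer.Theorems.MazurTateCongruenceAtTwoR.DepletedLattice

end
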